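import Summits.MatrixMultiplication.OmegaCensus.STPPRepresentationCount

/-!
# ω-census (abelian STPP census): the cube density law beyond packing, `28k ≤ 3|H| + 12`

HONEST FRAMING (pub-omega census; verbatim): lottery ticket; floor = certified bounds/negative ranges.
Census STRUCTURE (seat pub-omega-stpp-1 gen 25, 2026-08-27), family (b2), STRUCTURE question Q7 (the threshold function of
`k` simultaneous `⟨2,2,2⟩` TPP triples).  Nothing here is progress on `ω`: the theorem is a necessary condition on STPP families in
finite abelian groups, i.e. a tool for EXCLUDING constructions (and by `STPP222NeverBeats.lean` this whole class never beats
the sum of cubes anyway).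

## The theorem

For an STPP family `(Aᵢ, Bᵢ, Cᵢ)_{i<k}` (CKSU 2005 Def. 5.1, the tree's `IsSTPP`) in a finite abelian group `H` with all
`|Aᵢ| = |Bᵢ| = |Cᵢ| = 2` ("`(2,2,2)^k`"):  **`28·k ≤ 3·|H| + 12`**, i.e. `|H| ≥ ⌈(28k − 12)/3⌉ ≈ 9.33k − 4`
(`twentyeight_mul_le_three_mul_card_add`).  The packing/volume law of the tree is `8k ≤ |H|` (`CubeNB.eight_mul_le_card`,
tight at `k = 1`: `ℤ₈`); the present law is strictly stronger for every `k ≥ 4` (`k = 4: 34 > 32`, `k = 6: 52 > 48`,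
`k = 10: 90 > 80`), so asymptotically `k` simultaneous cubes fill at most `3/28 + o(1) < 1/8` of a finite abelian group.
(Measured onsets for comparison, ENGINE/KERNEL-upper grade of the census: `n₂ = 24, n₃ = 40, n₄ = 56, n₅ = 72`.)

## Proof (all in the kernel below)

With `X = ⋃ᵢ(Bᵢ − Aᵢ)`, `Y = ⋃ᵢ(Cᵢ − Bᵢ)`, `Z = ⋃ᵢ(Cᵢ − Aᵢ)` (`STPPKneserFilter.lean` §2; `|X| = |Y| = |Z| = m = 4k`) Def. 5.1 gives,
besides the representation count `rep X Y z = 2` on `Z` (`rep_eq_card_B`), two further EXACT LOCAL COUNTS (§2):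
every translate `X + y` (`y ∈ Y_l`) meets `Z` in at most `|A_l| = 2` points and every `Y + x` (`x ∈ X_l`) meets `Z` in at most
`|C_l| = 2` points.  §1 is the abstract additive combinatorics of three sets `X, Y, Z ⊆ H` of size `m` with these three
properties (`seven_mul_le_three_mul_card_add`: `7m ≤ 3|H| + 12`):
* the translates `X + y`, `y ∈ Y`, all lie in `H ∖ Z` (size `n − m`) up to two points, so by inclusion–exclusion every
  `δ ∈ Y − Y` is a NEAR-PERIOD of `X`: `dif X δ = |X ∩ (X + δ)| ≥ σ := 3m − n − 4` (`le_dif_of_translate`); likewise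
  `X − X` consists of near-periods of `Y`;
* double counting `Σ_δ dif X δ = m²` gives `#(Y − Y)·σ ≤ m²` (`card_mul_le_of_le_dif`);
* KNESER (tree `Literature.Combinatorics.Additive.add_kneser`, with `K = Stab(Y − Y)` and `#K ∣ #(Y + K)`) gives the dichotomy
  `kneser_dichotomy`: either `2·#(Y − Y) ≥ 3·#Y`, or `Y − Y = K` (a subgroup, `Y` inside one coset);
* in the first case `3mσ ≤ 2m²`, i.e. `3σ ≤ 2m`, which is `7m ≤ 3n + 12`; if both `X − X` and `Y − Y` are subgroups then,
  `σ` being positive, a near-period is a difference, so `X − X = Y − Y =: D`, `X + Y` lies in ONE translate of `D`, that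
  translate contains `Z` (`m` points of `rep = 2`) and absorbs all `m²` sums, whence `#D ≥ 2m − 2` and `(2m − 2)σ ≤ m²` —
  again `3σ ≤ 2m` once `m ≥ 4` (and `m ≤ 3` is trivial from `m ≤ n`).
Commutativity is load-bearing (Kneser).  No census input.

References: H. Cohn, R. Kleinberg, B. Szegedy, C. Umans, FOCS 2005 (arXiv:math/0511460), Def. 5.1; M. Kneser, Math. Z. 58
(1953); M. B. Nathanson, *Additive Number Theory: Inverse Problems*, GTM 165, §4.
-/

open Finset
open scoped Pointwise

namespace Summit.MatrixMultiplication.OmegaCensus.CubeNB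

variable {H : Type*} [AddCommGroup H] [DecidableEq H]

/-! ## §1 Abstract additive combinatorics: near-periods from translate counts, Kneser dichotomy, the bound -/

section Abstract

variable [Fintype H] {X Y Z : Finset H} {m : ℕ}

/-- **Near-periods from the translate count.**  If `#X = m` and every translate `X + y` (`y ∈ Y`) meets `Z` (`#Z = m`) in
at most two points, then for `y, y' ∈ Y`: `dif X (y − y') = |X ∩ (X + (y − y'))| ≥ 3m − |H| − 4` (inclusion–exclusion of
the two translates inside `H ∖ Z`). [folklore] -/
theorem le_dif_of_translate (hX : #X = m) (hZ : #Z = m)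
    (hcol : ∀ y ∈ Y, #(X.filter fun x => x + y ∈ Z) ≤ 2) {y y' : H} (hy : y ∈ Y) (hy' : y' ∈ Y) :
    3 * m ≤ dif X (y - y') + Fintype.card H + 4 := by
  set S := X.filter fun x => x + y ∉ Z with hS
  set S' := X.filter fun x => x + y' ∉ Z with hS'
  have hSm : m ≤ #S + 2 := by
    have h := card_filter_add_card_filter_not (s := X) (fun x => x + y ∈ Z)
    have := hcol y hy
    rw [hX] at h
    simp only [hS]
    omega
  have hS'm : m ≤ #S' + 2 := by
    have h := card_filter_add_card_filter_not (s := X) (fun x => x + y' ∈ Z)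
    have := hcol y' hy'
    rw [hX] at h
    simp only [hS']
    omega
  set T := S.image fun x => x + y with hT
  set T' := S'.image fun x => x + y' with hT'
  have hTc : #T = #S := card_image_of_injective _ (add_left_injective y)
  have hT'c : #T' = #S' := card_image_of_injective _ (add_left_injective y')
  have hdisj : Disjoint (T ∪ T') Z := by
    rw [disjoint_left]
    intro g hg hgZ
    rcases mem_union.1 hg with hg | hg
    · obtain ⟨x, hx, rfl⟩ := mem_image.1 hg
      exact (mem_filter.1 hx).2 hgZ
    · obtain ⟨x, hx, rfl⟩ := mem_image.1 hg
      exact (mem_filter.1 hx).2 hgZ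
  have hUZ : #(T ∪ T') + #Z ≤ Fintype.card H := by
    rw [← card_union_of_disjoint hdisj]
    exact card_le_univ _
  have hIE := card_union_add_card_inter T T'
  have hinj : #(T ∩ T') ≤ dif X (y - y') := by
    rw [dif, ← card_image_of_injective (T ∩ T') (sub_left_injective (b := y'))]
    refine card_le_card fun x hx => ?_
    obtain ⟨g, hg, rfl⟩ := mem_image.1 hx
    obtain ⟨hg1, hg2⟩ := mem_inter.1 hg
    obtain ⟨x₁, hx₁, hgx₁⟩ := mem_image.1 hg1
    obtain ⟨x₂, hx₂, hgx₂⟩ := mem_image.1 hg2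
    rw [mem_filter]
    refine ⟨?_, ?_⟩
    · rw [← hgx₂, add_sub_cancel_right]; exact (mem_filter.1 hx₂).1
    · have e : g - y' - (y - y') = x₁ := by rw [← hgx₁]; abel
      rw [e]; exact (mem_filter.1 hx₁).1
  omega

/-- **Counting near-periods.**  If every `δ ∈ D` has `dif X δ ≥ σ` and `#X = m`, then `#D·σ ≤ m²`
(from `Σ_δ dif X δ = m²`, `sum_dif`). [folklore] -/
theorem card_mul_le_of_le_dif (hX : #X = m) {D : Finset H} {σ : ℕ} (hD : ∀ δ ∈ D, σ ≤ dif X δ) :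
    #D * σ ≤ m * m := by
  calc #D * σ = ∑ δ ∈ D, σ := by rw [sum_const, smul_eq_mul]
    _ ≤ ∑ δ ∈ D, dif X δ := sum_le_sum hD
    _ ≤ ∑ δ, dif X δ := sum_le_sum_of_subset_of_nonneg (subset_univ D) fun _ _ _ => Nat.zero_le _
    _ = m * m := by rw [sum_dif, hX]

omit [Fintype H] in
/-- **Kneser dichotomy for a difference set.**  For non-empty `Y` in a commutative group, with `K = Stab(Y − Y)`:
either `3·#Y ≤ 2·#(Y − Y)` (when `Y` meets at least two cosets of `K`, by Kneser `#(Y − Y) ≥ 2#(Y + K) − #K` and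
`#K ∣ #(Y + K)`), or `Y − Y = K` (so `Y − Y` is a subgroup and `Y` lies in one of its cosets).
[cite: Kneser1953] [cite: Nathanson1996, Thm 4.2] -/
theorem kneser_dichotomy (hYne : Y.Nonempty) : 3 * #Y ≤ 2 * #(Y - Y) ∨ Y - Y = (Y - Y).addStab := by
  have hE : Y - Y = Y + -Y := sub_eq_add_neg Y Y
  have hkn := Literature.Combinatorics.Additive.add_kneser Y (-Y)
  rw [← hE] at hkn
  set K := (Y - Y).addStab with hK
  have hEne : (Y - Y).Nonempty := hYne.sub hYne
  have hKne : K.Nonempty := hEne.addStab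
  have hdvd1 : #K ∣ #(Y + K) := card_addStab_dvd_card_add_addStab Y (Y - Y)
  have hdvd2 : #K ∣ #(-Y + K) := card_addStab_dvd_card_add_addStab (-Y) (Y - Y)
  have h1 : #Y ≤ #(Y + K) := card_le_card_add_right hKne
  have h2 : #Y ≤ #(-Y + K) := by
    rw [← card_neg Y]; exact card_le_card_add_right hKne
  have h3 : #K ≤ #(Y + K) := card_le_card_add_left hYne
  have hKpos : 0 < #K := hKne.card_pos
  by_cases hbig : 2 * #K ≤ #(Y + K) ∨ 2 * #K ≤ #(-Y + K)
  · left
    rcases hbig with hbig | hbig <;> omega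
  · right
    push Not at hbig
    -- `#(Y + K)` is a multiple of `#K` in `[#K, 2#K)`, hence `= #K`
    have hYK : #(Y + K) = #K := by
      obtain ⟨q, hq⟩ := hdvd1
      have hq1 : q = 1 := by
        rcases Nat.lt_or_ge q 2 with hq2 | hq2
        · interval_cases q
          · rw [hq, mul_zero] at h3; omega
          · rfl
        · have : #K * 2 ≤ #K * q := Nat.mul_le_mul_left _ hq2
          rw [← hq] at this; omega
      rw [hq, hq1, mul_one]
    -- every `y ∈ Y` has `y +ᵥ K = Y + K`
    have hcoset : ∀ y ∈ Y, y +ᵥ K = Y + K := fun y hy =>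
      eq_of_subset_of_card_le (vadd_finset_subset_add hy) (by rw [hYK, card_vadd_finset])
    apply Subset.antisymm
    · intro δ hδ
      obtain ⟨y, hy, y', hy', rfl⟩ := mem_sub.1 hδ
      have hmem : y ∈ y' +ᵥ K := by
        rw [hcoset y' hy', ← hcoset y hy]
        exact mem_vadd_finset.2 ⟨0, hEne.zero_mem_addStab, by simp⟩
      obtain ⟨κ, hκ, hyκ⟩ := mem_vadd_finset.1 hmem
      have e : y - y' = κ := by rw [← hyκ, vadd_eq_add]; abel
      rw [e]; exact hκ
    · intro κ hκ
      obtain ⟨y, hy⟩ := hYne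
      have h0 : (0 : H) ∈ Y - Y := mem_sub.2 ⟨y, hy, y, hy, sub_self y⟩
      have := (mem_addStab' hEne).1 hκ h0
      rwa [vadd_eq_add, add_zero] at this

/-- **The abstract density bound.**  `X, Y, Z ⊆ H` of size `m` with: two representations `z = x + y` of every `z ∈ Z`
(`rep X Y z = 2`), every translate `X + y` (`y ∈ Y`) meeting `Z` in at most two points, and every `Y + x` (`x ∈ X`) meeting
`Z` in at most two points.  Then `7m ≤ 3|H| + 12`.  (Near-periods + Kneser, see the file header.)
[cite: Kneser1953] [cite: Nathanson1996, §4.2] -/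
theorem seven_mul_le_three_mul_card_add (hX : #X = m) (hY : #Y = m) (hZ : #Z = m)
    (hrep : ∀ z ∈ Z, rep X Y z = 2)
    (hcol : ∀ y ∈ Y, #(X.filter fun x => x + y ∈ Z) ≤ 2)
    (hrow : ∀ x ∈ X, #(Y.filter fun y => y + x ∈ Z) ≤ 2) :
    7 * m ≤ 3 * Fintype.card H + 12 := by
  by_contra hlt
  push Not at hlt
  set n := Fintype.card H with hn
  have hmn : m ≤ n := hX ▸ card_le_univ X
  have hm4 : 4 ≤ m := by omega
  have hXne : X.Nonempty := card_pos.1 (by omega)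
  have hYne : Y.Nonempty := card_pos.1 (by omega)
  -- the near-period margin `σ = 3m − n − 4 ≥ 1`, with `3σ ≥ 2m + 1`
  obtain ⟨σ, hσ⟩ : ∃ σ, 3 * m = σ + n + 4 := ⟨3 * m - (n + 4), by omega⟩
  have hσpos : 0 < σ := by omega
  have h3σ : 2 * m + 1 ≤ 3 * σ := by omega
  -- near-periods
  have hNPX : ∀ δ ∈ Y - Y, σ ≤ dif X δ := by
    intro δ hδ
    obtain ⟨y, hy, y', hy', rfl⟩ := mem_sub.1 hδ
    have := le_dif_of_translate hX hZ hcol hy hy'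
    omega
  have hNPY : ∀ δ ∈ X - X, σ ≤ dif Y δ := by
    intro δ hδ
    obtain ⟨x, hx, x', hx', rfl⟩ := mem_sub.1 hδ
    have := le_dif_of_translate hY hZ hrow hx hx'
    omega
  have hcY : #(Y - Y) * σ ≤ m * m := card_mul_le_of_le_dif hX hNPX
  have hcX : #(X - X) * σ ≤ m * m := card_mul_le_of_le_dif hY hNPY
  -- Kneser dichotomies
  rcases kneser_dichotomy hYne with hge | hKY
  · rw [hY] at hge
    have h1 : 3 * m * σ ≤ 2 * #(Y - Y) * σ := Nat.mul_le_mul_right σ hge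
    have h2 : m * (2 * m + 1) ≤ m * (3 * σ) := Nat.mul_le_mul_left m h3σ
    nlinarith
  rcases kneser_dichotomy hXne with hge | hKX
  · rw [hX] at hge
    have h1 : 3 * m * σ ≤ 2 * #(X - X) * σ := Nat.mul_le_mul_right σ hge
    have h2 : m * (2 * m + 1) ≤ m * (3 * σ) := Nat.mul_le_mul_left m h3σ
    nlinarith
  -- both difference sets are subgroups; a near-period is a difference, so they coincide
  have hYX : Y - Y ⊆ X - X := by
    intro δ hδ
    have hd := hNPX δ hδ
    obtain ⟨x, hx⟩ : (X.filter fun x => x - δ ∈ X).Nonempty := card_pos.1 (by rw [← dif]; omega)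
    rw [mem_filter] at hx
    exact mem_sub.2 ⟨x, hx.1, x - δ, hx.2, by abel⟩
  have hXY : X - X ⊆ Y - Y := by
    intro δ hδ
    have hd := hNPY δ hδ
    obtain ⟨y, hy⟩ : (Y.filter fun y => y - δ ∈ Y).Nonempty := card_pos.1 (by rw [← dif]; omega)
    rw [mem_filter] at hy
    exact mem_sub.2 ⟨y, hy.1, y - δ, hy.2, by abel⟩
  have hDeq : X - X = Y - Y := Subset.antisymm hXY hYX
  -- the final count inside one translate of `D = Y − Y`
  obtain ⟨x₀, hx₀⟩ := hXne
  obtain ⟨y₀, hy₀⟩ := hYne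
  have hDne : (Y - Y).Nonempty := ⟨y₀ - y₀, mem_sub.2 ⟨y₀, hy₀, y₀, hy₀, rfl⟩⟩
  set D := Y - Y with hD
  set T := D.image fun δ => x₀ + y₀ + δ with hT
  have hTc : #T = #D := card_image_of_injective _ (add_right_injective (x₀ + y₀))
  have hsumT : ∀ x ∈ X, ∀ y ∈ Y, x + y ∈ T := by
    intro x hx y hy
    have h1 : x - x₀ ∈ D := hXY (mem_sub.2 ⟨x, hx, x₀, hx₀, rfl⟩)
    have h2 : y - y₀ ∈ D := mem_sub.2 ⟨y, hy, y₀, hy₀, rfl⟩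
    have h3 : (x - x₀) + (y - y₀) ∈ D := by
      rw [hKY] at h1
      exact (mem_addStab' hDne).1 h1 h2
    exact mem_image.2 ⟨_, h3, by abel⟩
  have hrep0 : ∀ g, g ∉ T → rep X Y g = 0 := by
    intro g hg
    rw [rep, card_eq_zero, filter_eq_empty_iff]
    intro x hx hxy
    have := hsumT x hx (g - x) hxy
    rw [add_sub_cancel] at this
    exact hg this
  have hZT : Z ⊆ T := by
    intro z hz
    by_contra h
    have := hrep0 z h
    rw [hrep z hz] at this
    exact absurd this two_ne_zero
  have hsum : ∑ g ∈ T, rep X Y g = m * m := by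
    rw [sum_subset (subset_univ T) (fun g _ hg => hrep0 g hg), sum_rep, hX, hY]
  have hup : ∑ g ∈ T, rep X Y g ≤ 2 * m + (#D - m) * m := by
    rw [← sum_sdiff hZT]
    have h1 : ∑ g ∈ Z, rep X Y g = 2 * m := by
      rw [sum_congr rfl hrep, sum_const, smul_eq_mul, hZ, mul_comm]
    have h2 : ∑ g ∈ T \ Z, rep X Y g ≤ #(T \ Z) * m := by
      rw [← smul_eq_mul]
      exact sum_le_card_nsmul _ _ _ fun g _ => hX ▸ rep_le_left X Y g
    rw [card_sdiff_of_subset hZT, hTc, hZ] at h2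
    omega
  have hDm : m ≤ #D := by rw [← hZ, ← hTc]; exact card_le_card hZT
  obtain ⟨e, he⟩ : ∃ e, #D = m + e := ⟨#D - m, by omega⟩
  have hkey : m * m ≤ 2 * m + e * m := by rw [he, Nat.add_sub_cancel_left] at hup; omega
  have hme : m ≤ 2 + e := by
    have : m * m ≤ (2 + e) * m := by nlinarith
    exact Nat.le_of_mul_le_mul_right this (by omega)
  rw [he] at hcY
  -- `(m + e)σ ≤ m²`, `e ≥ m − 2`, `3σ ≥ 2m + 1`, `m ≥ 4`: contradiction
  have h5 : (m + e) * (2 * m + 1) ≤ (m + e) * (3 * σ) := Nat.mul_le_mul_left _ h3σ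
  nlinarith

end Abstract

/-! ## §2 The STPP interface: the two translate counts -/

section STPP

open Literature.Computability.AlgebraicComplexity

variable {N : ℕ} {A B C : Fin N → Finset H}

/-- **Translate count, columns.**  For an STPP family and `y = c − b' ∈ Y_l` (`b' ∈ B_l`, `c ∈ C_l`): the `x ∈ X = ⋃ᵢ(Bᵢ − Aᵢ)`
with `x + y ∈ Z = ⋃ⱼ(C_j − A_j)` are among `b' − a`, `a ∈ A_l` (Def. 5.1 (ii) forces all indices `= l`, then the TPP of block
`l` forces the `B`- and `C`-letters to agree). [cite: CohnKleinbergSzegedyUmans2005, Def. 5.1] -/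
theorem filter_add_mem_subset_image_A (hS : IsSTPP A B C) {l : Fin N} {b' c : H} (hb' : b' ∈ B l) (hc : c ∈ C l) :
    (STPPKneser.DU A B univ).filter (fun x => x + (c - b') ∈ STPPKneser.DU A C univ) ⊆
      (A l).image (fun a => b' - a) := by
  intro x hx
  rw [mem_filter] at hx
  obtain ⟨hxX, hxZ⟩ := hx
  simp only [STPPKneser.DU, mem_biUnion, mem_univ, true_and] at hxX hxZ
  obtain ⟨i, hx⟩ := hxX
  obtain ⟨j, hz⟩ := hxZ
  obtain ⟨a, ha, b, hb, rfl⟩ := STPPKneser.mem_D.1 hx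
  obtain ⟨a', ha', c', hc', hz'⟩ := STPPKneser.mem_D.1 hz
  have hrel : (a - a') + (b' - b) + (c' - c) = 0 := by
    have e : c' = (b - a) + (c - b') + a' := by rw [← hz']; abel
    rw [e]; abel
  obtain ⟨hil, -, -, hbb, -⟩ := hS i l j a' ha' a ha b hb b' hb' c hc c' hc' hrel
  subst hil
  exact mem_image.2 ⟨a, ha, by rw [hbb]⟩

/-- **Translate count, rows.**  For an STPP family and `x = b − a ∈ X_l` (`a ∈ A_l`, `b ∈ B_l`): the `y ∈ Y = ⋃ᵢ(Cᵢ − Bᵢ)`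
with `y + x ∈ Z` are among `c − b`, `c ∈ C_l`. [cite: CohnKleinbergSzegedyUmans2005, Def. 5.1] -/
theorem filter_add_mem_subset_image_C (hS : IsSTPP A B C) {l : Fin N} {a b : H} (ha : a ∈ A l) (hb : b ∈ B l) :
    (STPPKneser.DU B C univ).filter (fun y => y + (b - a) ∈ STPPKneser.DU A C univ) ⊆
      (C l).image (fun c => c - b) := by
  intro y hy
  rw [mem_filter] at hy
  obtain ⟨hyY, hyZ⟩ := hy
  simp only [STPPKneser.DU, mem_biUnion, mem_univ, true_and] at hyY hyZ
  obtain ⟨i, hy⟩ := hyY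
  obtain ⟨j, hz⟩ := hyZ
  obtain ⟨b', hb', c, hc, rfl⟩ := STPPKneser.mem_D.1 hy
  obtain ⟨a', ha', c', hc', hz'⟩ := STPPKneser.mem_D.1 hz
  have hrel : (a - a') + (b' - b) + (c' - c) = 0 := by
    have e : c' = (c - b') + (b - a) + a' := by rw [← hz']; abel
    rw [e]; abel
  obtain ⟨hli, -, -, hbb, -⟩ := hS l i j a' ha' a ha b hb b' hb' c hc c' hc' hrel
  subst hli
  exact mem_image.2 ⟨c, hc, by rw [hbb]⟩

/-- Column count: for `y ∈ Y_l`, at most `|A_l|` elements `x ∈ X` have `x + y ∈ Z`. [cite: CohnKleinbergSzegedyUmans2005, Def. 5.1] -/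
theorem card_filter_add_mem_le_card_A (hS : IsSTPP A B C) {l : Fin N} {y : H} (hy : y ∈ STPPKneser.D B C l) :
    #((STPPKneser.DU A B univ).filter fun x => x + y ∈ STPPKneser.DU A C univ) ≤ #(A l) := by
  obtain ⟨b', hb', c, hc, rfl⟩ := STPPKneser.mem_D.1 hy
  exact (card_le_card (filter_add_mem_subset_image_A hS hb' hc)).trans card_image_le

/-- Row count: for `x ∈ X_l`, at most `|C_l|` elements `y ∈ Y` have `y + x ∈ Z`. [cite: CohnKleinbergSzegedyUmans2005, Def. 5.1] -/
theorem card_filter_add_mem_le_card_C (hS : IsSTPP A B C) {l : Fin N} {x : H} (hx : x ∈ STPPKneser.D A B l) :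
    #((STPPKneser.DU B C univ).filter fun y => y + x ∈ STPPKneser.DU A C univ) ≤ #(C l) := by
  obtain ⟨a, ha, b, hb, rfl⟩ := STPPKneser.mem_D.1 hx
  exact (card_le_card (filter_add_mem_subset_image_C hS ha hb)).trans card_image_le

/-! ## §3 The cube density law -/

/-- **THE CUBE DENSITY LAW BEYOND PACKING.**  Let `H` be a finite abelian group and `(Aᵢ, Bᵢ, Cᵢ)_{i<k}` an STPP family
(CKSU 2005 Def. 5.1) with all `|Aᵢ| = |Bᵢ| = |Cᵢ| = 2`.  Then `28·k ≤ 3·|H| + 12`, i.e. `|H| ≥ ⌈(28k − 12)/3⌉`: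
`k` simultaneous `⟨2,2,2⟩` TPP triples fill at most `3/28 + o(1)` of a finite abelian group (the packing law is `1/8`,
`eight_mul_le_card`; the new law is the stronger one for every `k ≥ 4`).  Proof: §1 applied to the three difference families
with `rep = |B_j| = 2` on `Z` (`rep_eq_card_B`) and the translate counts `≤ |A_l|, |C_l| = 2` (§2).
[cite: CohnKleinbergSzegedyUmans2005, Def. 5.1] [cite: Kneser1953] -/
theorem twentyeight_mul_le_three_mul_card_add [Fintype H] {k : ℕ} {A B C : Fin k → Finset H} (hS : IsSTPP A B C)
    (hc : ∀ i, #(A i) = 2 ∧ #(B i) = 2 ∧ #(C i) = 2) : 28 * k ≤ 3 * Fintype.card H + 12 := by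
  have hA : ∀ i, (A i).Nonempty := fun i => card_pos.1 (by rw [(hc i).1]; norm_num)
  have hB : ∀ i, (B i).Nonempty := fun i => card_pos.1 (by rw [(hc i).2.1]; norm_num)
  have hC : ∀ i, (C i).Nonempty := fun i => card_pos.1 (by rw [(hc i).2.2]; norm_num)
  have hX : #(STPPKneser.DU A B univ) = 4 * k := by
    rw [STPPKneser.card_DU_AB hS hC]; simp [hc]; ring
  have hY : #(STPPKneser.DU B C univ) = 4 * k := by
    rw [STPPKneser.card_DU_BC hS hA]; simp [hc]; ring
  have hZ : #(STPPKneser.DU A C univ) = 4 * k := by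
    rw [STPPKneser.card_DU_AC hS hB]; simp [hc]; ring
  have hrep : ∀ z ∈ STPPKneser.DU A C univ,
      rep (STPPKneser.DU A B univ) (STPPKneser.DU B C univ) z = 2 := by
    intro z hz
    obtain ⟨j, -, hz⟩ := mem_biUnion.1 hz
    rw [rep_eq_card_B hS hz, (hc j).2.1]
  have hcol : ∀ y ∈ STPPKneser.DU B C univ,
      #((STPPKneser.DU A B univ).filter fun x => x + y ∈ STPPKneser.DU A C univ) ≤ 2 := by
    intro y hy
    obtain ⟨l, -, hy⟩ := mem_biUnion.1 hy
    exact (card_filter_add_mem_le_card_A hS hy).trans (hc l).1.le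
  have hrow : ∀ x ∈ STPPKneser.DU A B univ,
      #((STPPKneser.DU B C univ).filter fun y => y + x ∈ STPPKneser.DU A C univ) ≤ 2 := by
    intro x hx
    obtain ⟨l, -, hx⟩ := mem_biUnion.1 hx
    exact (card_filter_add_mem_le_card_C hS hx).trans (hc l).2.2.le
  have := seven_mul_le_three_mul_card_add hX hY hZ hrep hcol hrow
  omega

/-- Numeric form: `|H| ≥ ⌈(28k − 12)/3⌉`, i.e. `28k − 12 ≤ 3|H|` (natural subtraction). [cite: CohnKleinbergSzegedyUmans2005, Def. 5.1] -/
theorem twentyeight_mul_sub_le [Fintype H] {k : ℕ} {A B C : Fin k → Finset H} (hS : IsSTPP A B C)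
    (hc : ∀ i, #(A i) = 2 ∧ #(B i) = 2 ∧ #(C i) = 2) : 28 * k - 12 ≤ 3 * Fintype.card H := by
  have := twentyeight_mul_le_three_mul_card_add hS hc
  omega

/-- `ZMod m` instance: `(2,2,2)^k ⊆ ℤ/m` forces `28k ≤ 3m + 12`. [cite: CohnKleinbergSzegedyUmans2005, Def. 5.1] -/
theorem twentyeight_mul_le_of_zmod {m k : ℕ} [NeZero m] {A B C : Fin k → Finset (ZMod m)} (hS : IsSTPP A B C)
    (hc : ∀ i, #(A i) = 2 ∧ #(B i) = 2 ∧ #(C i) = 2) : 28 * k ≤ 3 * m + 12 := by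
  have := twentyeight_mul_le_three_mul_card_add hS hc
  rwa [ZMod.card] at this

end STPP

end Summit.MatrixMultiplication.OmegaCensus.CubeNB
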